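import Literature.RepresentationTheory.TwistedCoinvariantsTypePeriodicity
import HarnessLib

/-!
# Finite-level traces of a representation of a compact group with commuting elements: character sums with
# two-point support, reflection symmetry, and the averaging identity between levels

Topic `RepresentationTheory`; namespace `Literature.RepresentationTheory.TwistedCoinv` (continuing
`TwistedCoinvariantsTypePeriodicity`).  KERNEL ONLY: theorems, 0 definitions, 0 named facts, 0 `sorry`.

These are the finite-group and finite-level tools of the abstract half of the `(U(1), U(1))` THETA DICHOTOMY
(`CompactAbelianTypeDichotomy.lean`: two multiplicity-free representations of a compact abelian group whose finite-level
traces satisfy `tr₂ = -θ · tr₁` off `{1, z₁}` have COMPLEMENTARY type sets up to the shift `θ`; cell `hodgecm-mathlib`,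
h413 road, SOCKETS-H413 §3 S6 «G2a», count-neutral capital).

* §1 (finite abelian group `A`, complex characters `ψ : AddChar (Additive A) ℂ`; pure algebra over Mathlib's
  orthogonality `AddChar.sum_apply_eq_zero_iff_ne_zero`).  `sum_addChar_apply_ofMul_eq_ite` (orthogonality over the
  group, read multiplicatively); **`apply_eq_apply_of_sum_eq_zero_off_pair`** — Fourier inversion with TWO-POINT SUPPORT:
  if the character sums `Σ_ψ c(ψ) ψ(z)` vanish at every `z ∉ {1, z₁}` then `c(ψ)` depends only on `ψ(z₁)`;
  `sum_filter_addChar_apply_eq_zero` (the parity classes `ψ(z₁) = ±1` have vanishing character sums off `{1, z₁}`,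
  `z₁² = 1`); **`sum_mul_apply_mul_eq_of_const_on_parity`** — REFLECTION SYMMETRY: a function constant on a parity class
  has `Σ_ψ n(ψ) ψ(z₁ z) = ∓ Σ_ψ n(ψ) ψ(z)`; **`add_eq_one_of_parity_of_norm_sum_ne`** — the COMBINATORIAL CORE: two
  multiplicity functions `n₁, n₂ ≤ 1` with `n₂(ψ θ) + n₁(ψ)` depending only on `ψ(z₁)` and ONE reflection asymmetry
  `‖Σ n₁ ψ(z₁ z)‖ ≠ ‖Σ n₁ ψ(z)‖` satisfy `n₂(ψ θ) + n₁(ψ) = 1` for all `ψ`.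
* §2 (compact `K` with commuting elements, `ρ` on `S`, subgroups `L' ≤ L` with `[L : L']` finite).
  **`trace_fixedPoints_eq_average`**: `tr(ρ(z) | S^{L}) = [L:L']⁻¹ Σ_{q ∈ L/L'} tr(ρ(z q̃) | S^{L'})` — the average
  `[L:L']⁻¹ Σ_q ρ(q̃)` projects `S^{L'}` onto `S^{L}` and the trace moves along it.

## References
* [Serre1977] J.-P. Serre, *Linear representations of finite groups*, GTM 42 (1977), §2.3 (orthogonality of characters,
  Fourier inversion on a finite abelian group), §2.6 Thm. 8.
* [BernsteinZelevinsky1976] I. N. Bernstein, A. V. Zelevinsky, Russian Math. Surveys 31 (1976), §2.1–2.3 (smooth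
  representations of compact totally disconnected groups, `V^{K₀} = ⊕_{ξ|K₀ = 1} V[ξ]`, averaging projectors).
-/

set_option autoImplicit false

noncomputable section

open scoped BigOperators

namespace Literature.RepresentationTheory.TwistedCoinv

/-! ## §1. Finite abelian groups: functions on the dual whose character sums vanish off `{1, z₁}` -/

section Finite

variable {A : Type*} [CommGroup A] [Fintype A]

/-- Orthogonality read multiplicatively: `Σ_ψ ψ(a) = 0` for `a ≠ 1`. [cite: Serre1977, §2.3] -/
theorem sum_addChar_apply_ofMul_eq_zero {a : A} (ha : a ≠ 1) :
    ∑ ψ : AddChar (Additive A) ℂ, ψ (Additive.ofMul a) = 0 :=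
  AddChar.sum_apply_eq_zero_iff_ne_zero.2 (by simpa using ha)

omit [Fintype A] in
/-- The values of a complex character at an element of order `≤ 2` are `±1`. [cite: Serre1977, §2.1 Prop. 1] -/
theorem addChar_apply_sq_eq_one (ψ : AddChar (Additive A) ℂ) {z₁ : A} (hz₁ : z₁ * z₁ = 1) :
    ψ (Additive.ofMul z₁) = 1 ∨ ψ (Additive.ofMul z₁) = -1 := by
  have h : ψ (Additive.ofMul z₁) * ψ (Additive.ofMul z₁) = 1 := by
    rw [← AddChar.map_add_eq_mul, ← ofMul_mul, hz₁, ofMul_one, AddChar.map_zero_eq_one]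
  rcases mul_self_eq_one_iff.1 h with h1 | h1
  · exact Or.inl h1
  · exact Or.inr h1

/-- Orthogonality over the group: `Σ_z φ(z) = |A| [φ = 1]`, read multiplicatively (re-index by a translation at
which `φ ≠ 1`). [cite: Serre1977, §2.3] -/
theorem sum_addChar_apply_ofMul_eq_ite (φ : AddChar (Additive A) ℂ) [Decidable (φ = 0)] :
    ∑ z : A, φ (Additive.ofMul z) = if φ = 0 then (Fintype.card A : ℂ) else 0 := by
  split_ifs with hφ
  · subst hφ
    simp only [AddChar.zero_apply, Finset.sum_const, Finset.card_univ, nsmul_eq_mul, mul_one]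
  · obtain ⟨a, ha⟩ : ∃ a : A, φ (Additive.ofMul a) ≠ 1 := by
      by_contra hall
      push Not at hall
      exact hφ (AddChar.ext (f := φ) (g := 0) fun x => by
        rw [AddChar.zero_apply]
        exact hall (Additive.toMul x))
    have hre : ∑ z : A, φ (Additive.ofMul z) = φ (Additive.ofMul a) * ∑ z : A, φ (Additive.ofMul z) := by
      rw [Finset.mul_sum, ← Equiv.sum_comp (Equiv.mulLeft a)]
      refine Finset.sum_congr rfl fun z _ => ?_
      rw [Equiv.coe_mulLeft, ofMul_mul, AddChar.map_add_eq_mul]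
    have h3 : (φ (Additive.ofMul a) - 1) * ∑ z : A, φ (Additive.ofMul z) = 0 := by
      rw [sub_mul, one_mul, ← hre, sub_self]
    exact (mul_eq_zero.1 h3).resolve_left (sub_ne_zero.2 ha)

/-- **Fourier inversion, two-point support.**  If the character sums `Σ_ψ c(ψ) ψ(z)` of a function `c` on the dual of
the finite abelian group `A` vanish at every `z ∉ {1, z₁}`, then `c(ψ)` depends only on `ψ(z₁)`.
[cite: Serre1977, §2.3] -/
theorem apply_eq_apply_of_sum_eq_zero_off_pair (c : AddChar (Additive A) ℂ → ℂ) (z₁ : A)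
    (hc : ∀ z : A, z ≠ 1 → z ≠ z₁ → ∑ ψ : AddChar (Additive A) ℂ, c ψ * ψ (Additive.ofMul z) = 0)
    (ψ ψ' : AddChar (Additive A) ℂ) (h : ψ (Additive.ofMul z₁) = ψ' (Additive.ofMul z₁)) : c ψ = c ψ' := by
  classical
  -- Fourier inversion: `|A| c(χ) = Σ_z (Σ_φ c(φ) φ(z)) χ(z)⁻¹`
  have hinv : ∀ χ : AddChar (Additive A) ℂ,
      (Fintype.card A : ℂ) * c χ = ∑ z : A, (∑ φ : AddChar (Additive A) ℂ, c φ * φ (Additive.ofMul z)) *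
        (χ (Additive.ofMul z))⁻¹ := by
    intro χ
    have hswap : ∑ z : A, (∑ φ : AddChar (Additive A) ℂ, c φ * φ (Additive.ofMul z)) * (χ (Additive.ofMul z))⁻¹ =
        ∑ φ : AddChar (Additive A) ℂ, c φ * ∑ z : A, (φ / χ) (Additive.ofMul z) := by
      simp only [Finset.sum_mul]
      rw [Finset.sum_comm]
      refine Finset.sum_congr rfl fun φ _ => ?_
      rw [Finset.mul_sum]
      refine Finset.sum_congr rfl fun z _ => ?_
      rw [AddChar.div_apply', div_eq_mul_inv, mul_assoc]
    rw [hswap]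
    have hval : ∀ φ : AddChar (Additive A) ℂ, ∑ z : A, (φ / χ) (Additive.ofMul z) =
        if φ / χ = 0 then (Fintype.card A : ℂ) else 0 := fun φ => sum_addChar_apply_ofMul_eq_ite (φ / χ)
    simp only [hval, mul_ite, mul_zero]
    have hφ : ∀ φ : AddChar (Additive A) ℂ, φ / χ = 0 ↔ φ = χ := fun φ => div_eq_one
    simp only [hφ, Finset.sum_ite_eq', Finset.mem_univ, if_true, mul_comm]
  -- the sums over `z` reduce to `z ∈ {1, z₁}`, where `χ(z)⁻¹` agrees for `χ = ψ, ψ'`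
  have hterm : ∀ z : A, (∑ φ : AddChar (Additive A) ℂ, c φ * φ (Additive.ofMul z)) * (ψ (Additive.ofMul z))⁻¹ =
      (∑ φ : AddChar (Additive A) ℂ, c φ * φ (Additive.ofMul z)) * (ψ' (Additive.ofMul z))⁻¹ := by
    intro z
    by_cases hz1 : z = 1
    · subst hz1
      simp only [ofMul_one, AddChar.map_zero_eq_one]
    · by_cases hz : z = z₁
      · subst hz
        rw [h]
      · rw [hc z hz1 hz, zero_mul, zero_mul]
  have hA : (Fintype.card A : ℂ) ≠ 0 := Nat.cast_ne_zero.2 Fintype.card_ne_zero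
  have key : (Fintype.card A : ℂ) * c ψ = (Fintype.card A : ℂ) * c ψ' := by
    rw [hinv ψ, hinv ψ', Finset.sum_congr rfl fun z _ => hterm z]
  exact mul_left_cancel₀ hA key

/-- **Parity sums vanish off `{1, z₁}`**: for `z ∉ {1, z₁}` and `z₁² = 1`,
`Σ_{ψ : ψ(z₁) = s} ψ(z) = 0` for `s = 1` and `s = -1` (half of `Σ_ψ (1 ± ψ(z₁)) ψ(z) = 0`).
[cite: Serre1977, §2.3] -/
theorem sum_filter_addChar_apply_eq_zero {z₁ z : A} (hz1 : z ≠ 1) (hz : z ≠ z₁) (s : ℂ) (hs : s = 1 ∨ s = -1)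
    (hz₁ : z₁ * z₁ = 1) :
    ∑ ψ ∈ Finset.univ.filter (fun ψ : AddChar (Additive A) ℂ => ψ (Additive.ofMul z₁) = s),
      ψ (Additive.ofMul z) = 0 := by
  classical
  -- `Σ_ψ ψ(z) = 0` and `Σ_ψ ψ(z₁) ψ(z) = Σ_ψ ψ(z₁ z) = 0`
  have h0 : ∑ ψ : AddChar (Additive A) ℂ, ψ (Additive.ofMul z) = 0 := sum_addChar_apply_ofMul_eq_zero hz1
  have h1 : ∑ ψ : AddChar (Additive A) ℂ, ψ (Additive.ofMul z₁) * ψ (Additive.ofMul z) = 0 := by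
    have hzz : z₁ * z ≠ 1 := by
      intro hzz
      apply hz
      calc z = z₁ * z₁ * z := by rw [hz₁, one_mul]
        _ = z₁ * (z₁ * z) := by rw [mul_assoc]
        _ = z₁ := by rw [hzz, mul_one]
    have := sum_addChar_apply_ofMul_eq_zero (A := A) hzz
    simpa only [ofMul_mul, AddChar.map_add_eq_mul] using this
  -- `2 Σ_{ψ(z₁) = s} ψ(z) = Σ_ψ (1 + s ψ(z₁)) ψ(z)` since `ψ(z₁) ∈ {±1}` and `s ∈ {±1}`
  have hsplit : (2 : ℂ) * ∑ ψ ∈ Finset.univ.filter (fun ψ : AddChar (Additive A) ℂ => ψ (Additive.ofMul z₁) = s),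
      ψ (Additive.ofMul z) = ∑ ψ : AddChar (Additive A) ℂ, (1 + s * ψ (Additive.ofMul z₁)) * ψ (Additive.ofMul z) := by
    rw [Finset.mul_sum, ← Finset.sum_filter_add_sum_filter_not Finset.univ
      (fun ψ : AddChar (Additive A) ℂ => ψ (Additive.ofMul z₁) = s)]
    have hA : ∀ ψ ∈ Finset.univ.filter (fun ψ : AddChar (Additive A) ℂ => ψ (Additive.ofMul z₁) = s),
        (1 + s * ψ (Additive.ofMul z₁)) * ψ (Additive.ofMul z) = 2 * ψ (Additive.ofMul z) := by
      intro ψ hψ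
      rw [Finset.mem_filter] at hψ
      rw [hψ.2]
      rcases hs with rfl | rfl <;> norm_num
    have hB : ∀ ψ ∈ Finset.univ.filter (fun ψ : AddChar (Additive A) ℂ => ¬ ψ (Additive.ofMul z₁) = s),
        (1 + s * ψ (Additive.ofMul z₁)) * ψ (Additive.ofMul z) = 0 := by
      intro ψ hψ
      rw [Finset.mem_filter] at hψ
      have hψ' : ψ (Additive.ofMul z₁) = -s := by
        rcases addChar_apply_sq_eq_one ψ hz₁ with h | h <;> rcases hs with rfl | rfl
        · exact absurd h hψ.2
        · rw [h]; norm_num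
        · rw [h]
        · exact absurd h hψ.2
      rw [hψ']
      have : (1 + s * -s : ℂ) = 0 := by rcases hs with rfl | rfl <;> norm_num
      rw [this, zero_mul]
    rw [Finset.sum_congr rfl hA, Finset.sum_congr rfl hB, Finset.sum_const_zero, add_zero]
  have hrhs : ∑ ψ : AddChar (Additive A) ℂ, (1 + s * ψ (Additive.ofMul z₁)) * ψ (Additive.ofMul z) = 0 := by
    simp only [add_mul, one_mul, Finset.sum_add_distrib, mul_assoc, ← Finset.mul_sum, h0, h1, mul_zero, add_zero]
  have h2 : (2 : ℂ) ≠ 0 := two_ne_zero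
  exact (mul_eq_zero.1 (hsplit.trans hrhs)).resolve_left h2

/-- **Reflection symmetry of a character sum that is constant on a parity class.**  If `n` is constant on the
characters with `ψ(z₁) = s` (`s = ±1`, `z₁² = 1`), then for `z ∉ {1, z₁}`:
`Σ_ψ n(ψ) ψ(z₁ z) = -s · Σ_ψ n(ψ) ψ(z)` (the class `ψ(z₁) = s` contributes `0` to both sums, the other class is
multiplied by `ψ(z₁) = -s`). [cite: Serre1977, §2.3] -/
theorem sum_mul_apply_mul_eq_of_const_on_parity (n : AddChar (Additive A) ℂ → ℂ) {z₁ : A} (hz₁ : z₁ * z₁ = 1)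
    (s : ℂ) (hs : s = 1 ∨ s = -1) (c : ℂ) (hc : ∀ ψ : AddChar (Additive A) ℂ, ψ (Additive.ofMul z₁) = s → n ψ = c)
    {z : A} (hz1 : z ≠ 1) (hz : z ≠ z₁) :
    ∑ ψ : AddChar (Additive A) ℂ, n ψ * ψ (Additive.ofMul (z₁ * z)) =
      -s * ∑ ψ : AddChar (Additive A) ℂ, n ψ * ψ (Additive.ofMul z) := by
  classical
  have hzz1 : z₁ * z ≠ 1 := by
    intro hzz
    apply hz
    calc z = z₁ * z₁ * z := by rw [hz₁, one_mul]
      _ = z₁ * (z₁ * z) := by rw [mul_assoc]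
      _ = z₁ := by rw [hzz, mul_one]
  have hzz : z₁ * z ≠ z₁ := by
    intro hzz
    exact hz1 (mul_left_cancel (hzz.trans (mul_one z₁).symm))
  -- the class `ψ(z₁) = s` contributes `c · Σ_{ψ(z₁) = s} ψ(w) = 0` at `w = z` and `w = z₁ z`
  have hPsum : ∀ w : A, w ≠ 1 → w ≠ z₁ →
      ∑ ψ ∈ Finset.univ.filter (fun ψ : AddChar (Additive A) ℂ => ψ (Additive.ofMul z₁) = s),
        n ψ * ψ (Additive.ofMul w) = 0 := by
    intro w hw1 hw
    have h0 := sum_filter_addChar_apply_eq_zero (A := A) hw1 hw s hs hz₁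
    calc ∑ ψ ∈ Finset.univ.filter (fun ψ : AddChar (Additive A) ℂ => ψ (Additive.ofMul z₁) = s),
          n ψ * ψ (Additive.ofMul w)
        = ∑ ψ ∈ Finset.univ.filter (fun ψ : AddChar (Additive A) ℂ => ψ (Additive.ofMul z₁) = s),
          c * ψ (Additive.ofMul w) := by
          refine Finset.sum_congr rfl fun ψ hψ => ?_
          rw [Finset.mem_filter] at hψ
          rw [hc ψ hψ.2]
      _ = 0 := by rw [← Finset.mul_sum, h0, mul_zero]
  -- on the other class `ψ(z₁) = -s`
  have hQ : ∀ ψ ∈ Finset.univ.filter (fun ψ : AddChar (Additive A) ℂ => ¬ ψ (Additive.ofMul z₁) = s),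
      ψ (Additive.ofMul z₁) = -s := by
    intro ψ hψ
    rw [Finset.mem_filter] at hψ
    rcases addChar_apply_sq_eq_one ψ hz₁ with h | h <;> rcases hs with rfl | rfl
    · exact absurd h hψ.2
    · rw [h]; norm_num
    · rw [h]
    · exact absurd h hψ.2
  rw [← Finset.sum_filter_add_sum_filter_not Finset.univ (fun ψ : AddChar (Additive A) ℂ => ψ (Additive.ofMul z₁) = s),
    ← Finset.sum_filter_add_sum_filter_not Finset.univ (fun ψ : AddChar (Additive A) ℂ => ψ (Additive.ofMul z₁) = s)
      (fun ψ => n ψ * ψ (Additive.ofMul z)),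
    hPsum (z₁ * z) hzz1 hzz, hPsum z hz1 hz, zero_add, zero_add, Finset.mul_sum]
  refine Finset.sum_congr rfl fun ψ hψ => ?_
  rw [ofMul_mul, AddChar.map_add_eq_mul, hQ ψ hψ]
  ring

/-- **The combinatorial core (finite abelian group `A`).**  Let `n₁, n₂ ≤ 1` be two multiplicity functions on the dual
of `A`, `z₁` with `z₁² = 1`, `θ` a character, and suppose `D(ψ) := n₂(ψ θ) + n₁(ψ)` depends only on `ψ(z₁)`
(two-point support of the character sums of `D`, `apply_eq_apply_of_sum_eq_zero_off_pair`).  If for some `z ∉ {1, z₁}`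
the character sums of `n₁` at `z` and at `z₁ z` have DIFFERENT norms (reflection asymmetry), then `D ≡ 1`: the
supports of `n₁` and of `n₂(· θ)` are COMPLEMENTARY.  (On a parity class where `D = 0` or `D = 2` the function `n₁`
would be constant, and the reflection symmetry `sum_mul_apply_mul_eq_of_const_on_parity` would equate the norms.)
[cite: Serre1977, §2.3] -/
theorem add_eq_one_of_parity_of_norm_sum_ne (n₁ n₂ : AddChar (Additive A) ℂ → ℕ)
    (h₁ : ∀ ψ, n₁ ψ ≤ 1) (h₂ : ∀ ψ, n₂ ψ ≤ 1) {z₁ : A} (hz₁ : z₁ * z₁ = 1)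
    (θ : AddChar (Additive A) ℂ)
    (hD : ∀ ψ ψ' : AddChar (Additive A) ℂ, ψ (Additive.ofMul z₁) = ψ' (Additive.ofMul z₁) →
      n₂ (ψ * θ) + n₁ ψ = n₂ (ψ' * θ) + n₁ ψ')
    {z : A} (hz1 : z ≠ 1) (hz : z ≠ z₁)
    (hasym : ‖∑ ψ : AddChar (Additive A) ℂ, (n₁ ψ : ℂ) * ψ (Additive.ofMul (z₁ * z))‖ ≠
      ‖∑ ψ : AddChar (Additive A) ℂ, (n₁ ψ : ℂ) * ψ (Additive.ofMul z)‖) :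
    ∀ ψ : AddChar (Additive A) ℂ, n₂ (ψ * θ) + n₁ ψ = 1 := by
  -- if `n₁` is constant on a parity class the two norms agree: so it is not
  have hnc : ∀ (s : ℂ), (s = 1 ∨ s = -1) → ∀ c : ℂ,
      ¬ ∀ ψ : AddChar (Additive A) ℂ, ψ (Additive.ofMul z₁) = s → (n₁ ψ : ℂ) = c := by
    intro s hs c hc
    apply hasym
    rw [sum_mul_apply_mul_eq_of_const_on_parity (fun ψ => (n₁ ψ : ℂ)) hz₁ s hs c hc hz1 hz, norm_mul, norm_neg]
    rcases hs with rfl | rfl <;> simp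
  -- the value of `D` on a parity class is `1`
  have hval : ∀ (s : ℂ), (s = 1 ∨ s = -1) → ∀ ψ₀ : AddChar (Additive A) ℂ, ψ₀ (Additive.ofMul z₁) = s →
      n₂ (ψ₀ * θ) + n₁ ψ₀ = 1 := by
    intro s hs ψ₀ hψ₀
    have hle : n₂ (ψ₀ * θ) + n₁ ψ₀ ≤ 2 := by have := h₁ ψ₀; have := h₂ (ψ₀ * θ); omega
    rcases Nat.lt_or_ge (n₂ (ψ₀ * θ) + n₁ ψ₀) 1 with h0 | hge
    · -- `D = 0` on the class: `n₁ = 0` there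
      exfalso
      refine hnc s hs 0 fun ψ hψ => ?_
      have := hD ψ ψ₀ (hψ.trans hψ₀.symm)
      have : n₁ ψ = 0 := by omega
      rw [this, Nat.cast_zero]
    · rcases Nat.lt_or_ge (n₂ (ψ₀ * θ) + n₁ ψ₀) 2 with h1 | h2
      · omega
      · -- `D = 2` on the class: `n₁ = 1` there
        exfalso
        refine hnc s hs 1 fun ψ hψ => ?_
        have := hD ψ ψ₀ (hψ.trans hψ₀.symm)
        have := h₂ (ψ * θ)
        have : n₁ ψ = 1 := by have := h₁ ψ; omega
        rw [this, Nat.cast_one]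
  intro ψ
  rcases addChar_apply_sq_eq_one ψ hz₁ with h | h
  · exact hval 1 (Or.inl rfl) ψ h
  · exact hval (-1) (Or.inr rfl) ψ h

end Finite

/-! ## §2. Compact groups with commuting elements: the averaging identity between two levels -/

section Compact

variable {K : Type*} [Group K] [TopologicalSpace K] [IsTopologicalGroup K] [CompactSpace K]
  {S : Type*} [AddCommGroup S] [Module ℂ S] (ρ : Representation ℂ K S)

omit [TopologicalSpace K] [IsTopologicalGroup K] [CompactSpace K] in
/-- **trace transfer along an averaging projector**: for `W ≤ U` finite-dimensional, `T` preserving `W`, `P = id` on `W`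
and `T ∘ P` mapping `U` into `W`, `tr(T|W) = tr(T ∘ P|U)` (both are the trace of `U → W → U`).
[cite: BernsteinZelevinsky1976, §2.1] -/
private theorem trace_restrict_eq_trace_comp_restrict (W U : Submodule ℂ S) [FiniteDimensional ℂ U] (hWU : W ≤ U)
    (T P : S →ₗ[ℂ] S) (hT : ∀ w ∈ W, T w ∈ W) (hP : ∀ w ∈ W, P w = w) (hTP : ∀ u ∈ U, T (P u) ∈ W) :
    LinearMap.trace ℂ W (T.restrict hT) =
      LinearMap.trace ℂ U ((T ∘ₗ P).restrict (fun u hu => hWU (hTP u hu))) := by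
  haveI : FiniteDimensional ℂ W := Submodule.finiteDimensional_of_le hWU
  let g : U →ₗ[ℂ] W := ((T ∘ₗ P).domRestrict U).codRestrict W (fun u => hTP u u.2)
  let i : W →ₗ[ℂ] U := Submodule.inclusion hWU
  have h1 : (T ∘ₗ P).restrict (fun u hu => hWU (hTP u hu)) = i ∘ₗ g := by
    apply LinearMap.ext; intro u; rfl
  have h2 : T.restrict hT = g ∘ₗ i := by
    apply LinearMap.ext; intro w
    apply Subtype.ext
    show T w = T (P w)
    rw [hP w w.2]
  rw [h1, h2]
  exact LinearMap.trace_comp_comm' i g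

omit [TopologicalSpace K] [IsTopologicalGroup K] [CompactSpace K] in
/-- **The finite-level trace is an average over a deeper level.**  For subgroups `L' ≤ L` of `K` (elements of `K`
commuting) with `[L : L']` finite and `S^{L'}` finite-dimensional,
`tr(ρ(z) | S^{L}) = [L:L']⁻¹ Σ_{q ∈ L/L'} tr(ρ(z q̃) | S^{L'})` (`q̃` any representatives): the average
`P = [L:L']⁻¹ Σ_q ρ(q̃)` projects `S^{L'}` onto `S^{L}`. [cite: BernsteinZelevinsky1976, §2.1–2.3] -/
theorem trace_fixedPoints_eq_average (hcomm : ∀ a b : K, a * b = b * a) (L L' : Subgroup K) (hL'L : L' ≤ L)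
    [Fintype (L ⧸ L'.subgroupOf L)] [Module.Finite ℂ (ρ.fixedPoints L')] (z : K) :
    LinearMap.trace ℂ (ρ.fixedPoints L) ((ρ z).restrict (apply_mem_fixedPoints_of_comm ρ hcomm L z)) =
      (Fintype.card (L ⧸ L'.subgroupOf L) : ℂ)⁻¹ *
        ∑ q : L ⧸ L'.subgroupOf L, LinearMap.trace ℂ (ρ.fixedPoints L')
          ((ρ (z * ((q.out : L) : K))).restrict (apply_mem_fixedPoints_of_comm ρ hcomm L' _)) := by
  classical
  have hWU : ρ.fixedPoints L ≤ ρ.fixedPoints L' := ρ.fixedPoints_antitone hL'L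
  -- the averaging operator `P = [L:L']⁻¹ Σ_q ρ(q̃)`
  set P : S →ₗ[ℂ] S := (Fintype.card (L ⧸ L'.subgroupOf L) : ℂ)⁻¹ •
    ∑ q : L ⧸ L'.subgroupOf L, ρ ((q.out : L) : K) with hP
  have hPfix : ∀ w ∈ ρ.fixedPoints L, P w = w := by
    intro w hw
    rw [Representation.mem_fixedPoints] at hw
    rw [hP, LinearMap.smul_apply, LinearMap.coe_sum, Finset.sum_apply]
    have : ∀ q : L ⧸ L'.subgroupOf L, ρ ((q.out : L) : K) w = w := fun q => hw _ (q.out : L).2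
    simp only [this, Finset.sum_const, Finset.card_univ, ← Nat.cast_smul_eq_nsmul ℂ, smul_smul]
    rw [inv_mul_cancel₀ (Nat.cast_ne_zero.2 Fintype.card_ne_zero), one_smul]
  -- `P` maps `S^{L'}` into `S^{L}`: for `k ∈ L`, `ρ(k)` permutes the summands up to elements of `L'`
  have hPinv : ∀ u ∈ ρ.fixedPoints L', ∀ k ∈ L, ρ k (P u) = P u := by
    intro u hu k hk
    rw [Representation.mem_fixedPoints] at hu
    rw [hP, LinearMap.smul_apply, LinearMap.coe_sum, Finset.sum_apply, map_smul, map_sum]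
    congr 1
    set k' : L := ⟨k, hk⟩ with hk'
    have hterm : ∀ q : L ⧸ L'.subgroupOf L,
        ρ k (ρ ((q.out : L) : K) u) = ρ (((k' • q).out : L) : K) u := by
      intro q
      obtain ⟨h, hh⟩ := QuotientGroup.mk_out_eq_mul (L'.subgroupOf L) (k' * q.out)
      have hmk : (QuotientGroup.mk (k' * q.out) : L ⧸ L'.subgroupOf L) = k' • q := by
        rw [← smul_eq_mul, ← MulAction.Quotient.smul_mk, QuotientGroup.out_eq']
      have hh' : ((h : L) : K) ∈ L' := Subgroup.mem_subgroupOf.1 h.2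
      rw [← hmk, hh, Subgroup.coe_mul, Subgroup.coe_mul, map_mul, map_mul, Module.End.mul_apply,
        Module.End.mul_apply, hu _ hh']
    simp only [hterm]
    exact Fintype.sum_equiv (MulAction.toPerm k') _ (fun q : L ⧸ L'.subgroupOf L => ρ ((q.out : L) : K) u)
      fun q => rfl
  have hTP : ∀ u ∈ ρ.fixedPoints L', ρ z (P u) ∈ ρ.fixedPoints L := by
    intro u hu
    apply apply_mem_fixedPoints_of_comm ρ hcomm L z
    rw [Representation.mem_fixedPoints]
    exact hPinv u hu
  rw [trace_restrict_eq_trace_comp_restrict (ρ.fixedPoints L) (ρ.fixedPoints L') hWU (ρ z) P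
    (apply_mem_fixedPoints_of_comm ρ hcomm L z) hPfix hTP]
  -- `ρ(z) ∘ P = [L:L']⁻¹ Σ_q ρ(z q̃)` and linearity of the trace, inside `End(S^{L'})`
  have hrestr : (ρ z ∘ₗ P).restrict (fun u hu => hWU (hTP u hu)) =
      (Fintype.card (L ⧸ L'.subgroupOf L) : ℂ)⁻¹ • ∑ q : L ⧸ L'.subgroupOf L,
        (ρ (z * ((q.out : L) : K))).restrict (apply_mem_fixedPoints_of_comm ρ hcomm L' _) := by
    apply LinearMap.ext
    intro u
    apply Subtype.ext
    simp only [LinearMap.restrict_apply, LinearMap.coe_comp, Function.comp_apply, hP, LinearMap.smul_apply,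
      LinearMap.coe_sum, Finset.sum_apply, map_smul, map_sum, Submodule.coe_smul_of_tower, Submodule.coe_sum,
      map_mul, Module.End.mul_apply]
  rw [hrestr, map_smul, map_sum, smul_eq_mul]

end Compact

end Literature.RepresentationTheory.TwistedCoinv

end
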